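import Summits.QuantumFields.YangMills.Theorems.SmallCircleAnchorAnchorGapCovDecPtFactorization
import HarnessLib

/-!
# Crux `AnchorGap` (stmt-QuantumFields-11141), line `registered` — the `Y`-factor of GREP's
# factorisation is INTRINSIC: at a decoupled point, `E(cov X σ_s)(F) = E(cov Y σ_s)(F)` for `F`
# seeing only the atoms of the point set `Y` of `s` (step (G5) of the assembly of GREP, part: step
# (d), second half of LOCATE-GREP v2)

After ✓(G3) `DecPt.gaussExpect_decPt_mul_eq` (px19 g17, p792320) the peeled expectation of GREP
(`stub_gaussianBBFPolymerRep`) at the decoupled point `σ_s(t)` of a valid script `s` with point set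
`Y = univ.image s.y ⊆ X` splits as `E(cov X σ_s)(F) · E(cov (X∖Y) 1)(G)`, the `Y`-factor still
written with the covariance `cov X σ_s` of the BIG atom set.  GREP's activity `K Y` is written with
`cov Y σ_s`.  The two agree on every `F` seeing only the atoms of `Y`: both covariances have no entry
between `blk⁻¹Y` and its complement (✓`DecPt.cov_decPt_cross_eq_zero`; for `cov Y σ` this holds at
EVERY `σ`) and they coincide on `blk⁻¹Y × blk⁻¹Y`, so the intrinsic-marginal clause of ✓FACT
(`stub_gaussianCovBlockFactor`, conjunct 2) expresses both sides by the same marginal integral.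

* `submatrix_eq_of_eqOn` — equal `S`-blocks give equal `S`-submatrices;
* `gaussExpect_eq_of_blocks` — GENERIC: two positive definite covariances, both decoupled across `S`
  and equal on `S × S`, give the same normalised expectation to every `F` seeing only `S`
  (✓FACT conjunct 2 on both sides);
* `cov_cross_eq_zero_of_subset` — `cov Y σ` has no entries between `blk⁻¹Y` and the rest, any `σ`;
* `gaussExpect_cov_decPt_eq_cov_pts` — the GREP instance: `E(cov X σ_s(t))(F) = E(cov Y σ_s(t))(F)`,
  `Y = univ.image s.y ⊆ X`, `F` seeing only the atoms of `Y` (the `hF` shape of ✓(G3)), with GREP's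
  `cov` ∕ `E` texts INLINED token for token.

[folklore] Gaussian bookkeeping; no definition, no named fact.
-/

set_option autoImplicit false

namespace Summit.QuantumFields.YangMills.Theorems.AnchorGap.CovMarginal

open Finset MvPolynomial MeasureTheory Literature.Probability.LatticeModels
  Literature.Probability.LatticeModels.BattleFederbush Literature.MeasureTheory.Integral
open scoped Matrix

variable {ι : Type} [Fintype ι] [DecidableEq ι]

omit [Fintype ι] [DecidableEq ι] in
/-- Equal `S`-blocks give equal `S`-submatrices. [folklore] -/
theorem submatrix_eq_of_eqOn {M M' : Matrix ι ι ℝ} (S : Finset ι)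
    (hS : ∀ i ∈ S, ∀ j ∈ S, M i j = M' i j) :
    M.submatrix (Subtype.val : ↥S → ι) (Subtype.val : ↥S → ι)
      = M'.submatrix (Subtype.val : ↥S → ι) (Subtype.val : ↥S → ι) :=
  Matrix.ext fun a b => hS a.1 a.2 b.1 b.2

/-- **Two block-decoupled covariances with the same `S`-block give the same expectation to every
observable seeing only `S`** (✓FACT `stub_gaussianCovBlockFactor`, intrinsic-marginal clause, on
both sides). [folklore] -/
theorem gaussExpect_eq_of_blocks (M M' : Matrix ι ι ℝ) (hM : M.PosDef) (hM' : M'.PosDef)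
    (S : Finset ι) (hMz : ∀ i j : ι, ¬ (i ∈ S ↔ j ∈ S) → M i j = 0)
    (hM'z : ∀ i j : ι, ¬ (i ∈ S ↔ j ∈ S) → M' i j = 0)
    (hS : ∀ i ∈ S, ∀ j ∈ S, M i j = M' i j)
    (F : (ι → ℝ) → ℝ) (hF : ∀ φ ψ : ι → ℝ, (∀ i ∈ S, φ i = ψ i) → F φ = F ψ) :
    (∫ φ : ι → ℝ, F φ * Real.exp (-(φ ⬝ᵥ (M⁻¹ *ᵥ φ)) / 2))
        / (∫ φ : ι → ℝ, Real.exp (-(φ ⬝ᵥ (M⁻¹ *ᵥ φ)) / 2))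
      = (∫ φ : ι → ℝ, F φ * Real.exp (-(φ ⬝ᵥ (M'⁻¹ *ᵥ φ)) / 2))
        / (∫ φ : ι → ℝ, Real.exp (-(φ ⬝ᵥ (M'⁻¹ *ᵥ φ)) / 2)) := by
  have hG : ∀ φ ψ : ι → ℝ, (∀ i, i ∉ S → φ i = ψ i) → (fun _ : ι → ℝ => (1 : ℝ)) φ
      = (fun _ : ι → ℝ => (1 : ℝ)) ψ := fun _ _ _ => rfl
  have h1 := (stub_gaussianCovBlockFactor ι M hM S hMz F (fun _ => 1) hF hG).2
  have h2 := (stub_gaussianCovBlockFactor ι M' hM' S hM'z F (fun _ => 1) hF hG).2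
  rw [h1, h2, submatrix_eq_of_eqOn S hS]

variable {β : Type} [Fintype β] [DecidableEq β] {r : β} {k : ℕ}

omit [DecidableEq ι] [Fintype β] in
/-- **`cov Y σ` has no entries between the atoms of `Y` and the other atoms**, at every parameter
`σ`. [folklore] -/
theorem cov_cross_eq_zero_of_subset (blk : ι → β) (C : Matrix ι ι ℝ) (Y : Finset β)
    (σ : Sym2 β → ℝ) (i j : ι)
    (hij : ¬ (i ∈ univ.filter (fun i => blk i ∈ Y) ↔ j ∈ univ.filter (fun i => blk i ∈ Y))) :
    (if blk i = blk j then 1 else if blk i ∈ Y ∧ blk j ∈ Y then σ s(blk i, blk j) else 0) * C i j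
      = 0 := by
  simp only [mem_filter, mem_univ, true_and] at hij
  have hne : blk i ≠ blk j := fun h => hij (by rw [h])
  have hnot : ¬ (blk i ∈ Y ∧ blk j ∈ Y) := fun h => hij ⟨fun _ => h.2, fun _ => h.1⟩
  rw [if_neg hne, if_neg hnot, zero_mul]

/-- **The `Y`-factor of GREP's factorisation is intrinsic.** For a valid script `s` with point set
`Y = univ.image s.y ⊆ X`, a cube parameter `t`, and `F` seeing only the atoms of `Y` (the `hF` of
✓`DecPt.gaussExpect_decPt_mul_eq`): `E(cov X σ_s(t))(F) = E(cov Y σ_s(t))(F)` — the covariance of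
GREP's activity `K Y`. [folklore] -/
theorem gaussExpect_cov_decPt_eq_cov_pts (blk : ι → β) (C : Matrix ι ι ℝ) (hC : C.PosDef)
    (X : Finset β) (s : Script r k) (hs : s.Valid) {t : β → ℝ} (ht : t ∈ unitCube β)
    (hYX : univ.image s.y ⊆ X) (F : (ι → ℝ) → ℝ)
    (hF : ∀ φ ψ : ι → ℝ, (∀ i, blk i ∈ univ.image s.y → φ i = ψ i) → F φ = F ψ) :
    (∫ φ : ι → ℝ, F φ * Real.exp (-(φ ⬝ᵥ ((Matrix.of fun i j : ι => (if blk i = blk j then 1 else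
        if blk i ∈ X ∧ blk j ∈ X then eval t (Script.decPt ℝ s s(blk i, blk j)) else 0) * C i j)⁻¹
          *ᵥ φ)) / 2))
      / (∫ φ : ι → ℝ, Real.exp (-(φ ⬝ᵥ ((Matrix.of fun i j : ι => (if blk i = blk j then 1 else
        if blk i ∈ X ∧ blk j ∈ X then eval t (Script.decPt ℝ s s(blk i, blk j)) else 0) * C i j)⁻¹
          *ᵥ φ)) / 2))
    = (∫ φ : ι → ℝ, F φ * Real.exp (-(φ ⬝ᵥ ((Matrix.of fun i j : ι => (if blk i = blk j then 1 else
        if blk i ∈ univ.image s.y ∧ blk j ∈ univ.image s.y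
          then eval t (Script.decPt ℝ s s(blk i, blk j)) else 0) * C i j)⁻¹ *ᵥ φ)) / 2))
      / (∫ φ : ι → ℝ, Real.exp (-(φ ⬝ᵥ ((Matrix.of fun i j : ι => (if blk i = blk j then 1 else
        if blk i ∈ univ.image s.y ∧ blk j ∈ univ.image s.y
          then eval t (Script.decPt ℝ s s(blk i, blk j)) else 0) * C i j)⁻¹ *ᵥ φ)) / 2)) := by
  classical
  set S : Finset ι := univ.filter fun i => blk i ∈ univ.image s.y with hSdef
  refine gaussExpect_eq_of_blocks _ _ (DecPt.posDef_cov_decPt blk C hC X s hs ht)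
    (DecPt.posDef_cov_decPt blk C hC (univ.image s.y) s hs ht) S
    (fun i j hij => by
      simp only [Matrix.of_apply]; exact DecPt.cov_decPt_cross_eq_zero blk C X s t i j hij)
    (fun i j hij => by
      simp only [Matrix.of_apply]
      exact cov_cross_eq_zero_of_subset blk C (univ.image s.y)
        (fun ℓ => eval t (Script.decPt ℝ s ℓ)) i j hij)
    (fun i hi j hj => ?_) F (fun φ ψ h => hF φ ψ fun i hi => h i (by simpa [hSdef] using hi))
  simp only [hSdef, mem_filter, mem_univ, true_and] at hi hj
  simp only [Matrix.of_apply]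
  by_cases h1 : blk i = blk j
  · rw [if_pos h1, if_pos h1]
  · rw [if_neg h1, if_neg h1, if_pos ⟨hYX hi, hYX hj⟩, if_pos ⟨hi, hj⟩]

end Summit.QuantumFields.YangMills.Theorems.AnchorGap.CovMarginal
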